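import Summits.AtomisticToContinuum.HydrodynamicLimit.Theorems.ImplosionDichotomyDenseExcursionConeLocalityAlgebra

/-!
# Cone locality for the athermal `5 × 5` Euler system — the zero-order source is dominated by the energy

Crux `Summit.AtomisticToContinuum.HydrodynamicLimit.Theses.ImplosionDichotomy.DenseExcursion`
(stmt-AtomisticToContinuum-12586), line `kidder-knob-melnikov`, stub `stub_coneLocality : HsEulerConeLocality`.
In Dafermos's energy method (Hyperbolic Conservation Laws in Continuum Physics, 2nd ed. 2005, proof of Thm 5.2.1)
the zero-order SOURCE produced by `ConeLocality.energy_algebra5` and the two integrations by parts (a bilinear form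
in the differences `α, w, β, ζ(P₁) − ζ(P₂), γ(P₁) − γ(P₂)` whose coefficients are the two solutions, their first
derivatives — taken WITHIN the slab `[0, t₁) × ℝ³`, so that they are continuous up to `t = 0` — and the derivatives
of the symmetriser weights) must be bounded by a constant times the rescaled relative energy
`ẽ = ½(Θ₁²γ(P₁)α² + P₁²Θ₁‖w‖² + (3/2)P₁²β²)` on the compact support of the cone weight. This file proves exactly
that (`exists_source_le_energy`), with NO term-by-term bookkeeping: the source, read as a function of the
space–time point `p` and of a free vector `v = (α, w, β, δζ, δγ)`, is jointly continuous and `2`-homogeneous in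
`v`, hence `≤ M₀‖v‖²` over the compact set (`ConeLocality.exists_bound_of_isCompact_of_homogeneous`); the
Lipschitz bounds of `ζ, γ` on `[a, b]` and the coercivity `ẽ ≥ (μ/2)(α² + ‖w‖² + β²)` (densities in `[a, b]`,
`a > 0`, temperature `≥ θ₀ > 0`, `γ ≥ γ₀ > 0` on `[a, b]`) finish. Theorem-only file.
-/

noncomputable section

open Set Filter MeasureTheory Metric
open scoped Topology ContDiff RealInnerProductSpace

namespace Summit.AtomisticToContinuum.HydrodynamicLimit.Theorems.KidderKnobMelnikov

namespace ConeLocality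

open Literature.Analysis.FluidPDE.IsentropicEuler
open Literature.MathematicalPhysics.KineticTheory (V3)

/-- The sup norm of `(α, w, β, δζ, δγ) ∈ ℝ × ℝ³ × ℝ × ℝ × ℝ` squared is at most the sum of the squares of the
components. [folklore] -/
theorem norm_sq_le_five (v : ℝ × V3 × ℝ × ℝ × ℝ) :
    ‖v‖ ^ 2 ≤ v.1 ^ 2 + ‖v.2.1‖ ^ 2 + v.2.2.1 ^ 2 + v.2.2.2.1 ^ 2 + v.2.2.2.2 ^ 2 := by
  set N : ℝ := v.1 ^ 2 + ‖v.2.1‖ ^ 2 + v.2.2.1 ^ 2 + v.2.2.2.1 ^ 2 + v.2.2.2.2 ^ 2 with hN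
  have h1 : v.1 ^ 2 ≤ N := by rw [hN]; nlinarith [sq_nonneg v.2.2.1, sq_nonneg v.2.2.2.1, sq_nonneg v.2.2.2.2]
  have h2 : ‖v.2.1‖ ^ 2 ≤ N := by
    rw [hN]; nlinarith [sq_nonneg v.1, sq_nonneg v.2.2.1, sq_nonneg v.2.2.2.1, sq_nonneg v.2.2.2.2]
  have h3 : v.2.2.1 ^ 2 ≤ N := by rw [hN]; nlinarith [sq_nonneg v.1, sq_nonneg v.2.2.2.1, sq_nonneg v.2.2.2.2]
  have h4 : v.2.2.2.1 ^ 2 ≤ N := by rw [hN]; nlinarith [sq_nonneg v.1, sq_nonneg v.2.2.1, sq_nonneg v.2.2.2.2]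
  have h5 : v.2.2.2.2 ^ 2 ≤ N := by rw [hN]; nlinarith [sq_nonneg v.1, sq_nonneg v.2.2.1, sq_nonneg v.2.2.2.1]
  have hN0 : 0 ≤ N := (sq_nonneg _).trans h1
  have h : ‖v‖ ≤ Real.sqrt N := by
    simp only [Prod.norm_def, Real.norm_eq_abs]
    exact max_le (Real.abs_le_sqrt h1) (max_le ((Real.le_sqrt (norm_nonneg _) hN0).2 h2)
      (max_le (Real.abs_le_sqrt h3) (max_le (Real.abs_le_sqrt h4) (Real.abs_le_sqrt h5))))
  calc ‖v‖ ^ 2 ≤ (Real.sqrt N) ^ 2 := pow_le_pow_left₀ (norm_nonneg _) h 2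
    _ = N := Real.sq_sqrt hN0

set_option maxHeartbeats 1600000 in
/-- **The zero-order source is dominated by the energy on the compact support of the weight.** For two triples
of fields `C¹` on the slab `[0, t₁) × ℝ³` (derivatives within the slab abbreviated `DU₁, DU₂, DP₂, DΘ₂` and, for
the symmetriser weights `Θ₁²γ(P₁)`, `P₁²Θ₁`, `(3/2)P₁²` and the flux coefficients `P₁Θ₁²γ(P₁)`, `P₁²Θ₁ζ(P₁)`,
`Dk, Dm, Dn, Da, Db`), `ζ, γ ∈ C¹(ℝ)`, and a compact `K` inside the slab on which the densities lie in `[a, b]`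
(`a > 0`), `Θ₁ ≥ θ₀ > 0` and `γ > 0` on `[a, b]`: the source term of the weighted energy identity is `≤ M ẽ` on `K`
for some constant `M` (continuity + `2`-homogeneity + compactness, Lipschitz bounds of `ζ, γ` on `[a, b]`,
coercivity of `ẽ`). [cite: Dafermos2005, §5.2, proof of Thm 5.2.1, (5.2.10)–(5.2.12)] -/
theorem exists_source_le_energy : ∀ {ζ γ : ℝ → ℝ} {P₁ Θ₁ P₂ Θ₂ : ℝ → V3 → ℝ} {U₁ U₂ : ℝ → V3 → V3}
    {t₁ a b θ₀ : ℝ} {K : Set (ℝ × V3)} {DU₁ DU₂ : ℝ × V3 → (ℝ × V3 →L[ℝ] V3)}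
    {DP₂ DΘ₂ Da Db Dk Dm Dn : ℝ × V3 → (ℝ × V3 →L[ℝ] ℝ)} {e src : ℝ → V3 → ℝ},
    ContDiff ℝ 1 ζ → ContDiff ℝ 1 γ →
    ContDiffOn ℝ 1 (fun p : ℝ × V3 => P₁ p.1 p.2) (Ico 0 t₁ ×ˢ univ) →
    ContDiffOn ℝ 1 (fun p : ℝ × V3 => Θ₁ p.1 p.2) (Ico 0 t₁ ×ˢ univ) →
    ContDiffOn ℝ 1 (fun p : ℝ × V3 => U₁ p.1 p.2) (Ico 0 t₁ ×ˢ univ) →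
    ContDiffOn ℝ 1 (fun p : ℝ × V3 => P₂ p.1 p.2) (Ico 0 t₁ ×ˢ univ) →
    ContDiffOn ℝ 1 (fun p : ℝ × V3 => Θ₂ p.1 p.2) (Ico 0 t₁ ×ˢ univ) →
    ContDiffOn ℝ 1 (fun p : ℝ × V3 => U₂ p.1 p.2) (Ico 0 t₁ ×ˢ univ) →
    (∀ p, DU₁ p = fderivWithin ℝ (fun q : ℝ × V3 => U₁ q.1 q.2) (Ico 0 t₁ ×ˢ univ) p) →
    (∀ p, DU₂ p = fderivWithin ℝ (fun q : ℝ × V3 => U₂ q.1 q.2) (Ico 0 t₁ ×ˢ univ) p) →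
    (∀ p, DP₂ p = fderivWithin ℝ (fun q : ℝ × V3 => P₂ q.1 q.2) (Ico 0 t₁ ×ˢ univ) p) →
    (∀ p, DΘ₂ p = fderivWithin ℝ (fun q : ℝ × V3 => Θ₂ q.1 q.2) (Ico 0 t₁ ×ˢ univ) p) →
    (∀ p, Da p = fderivWithin ℝ (fun q : ℝ × V3 => P₁ q.1 q.2 * Θ₁ q.1 q.2 ^ 2 * γ (P₁ q.1 q.2)) (Ico 0 t₁ ×ˢ univ) p) →
    (∀ p, Db p = fderivWithin ℝ (fun q : ℝ × V3 => P₁ q.1 q.2 ^ 2 * Θ₁ q.1 q.2 * ζ (P₁ q.1 q.2)) (Ico 0 t₁ ×ˢ univ) p) →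
    (∀ p, Dk p = fderivWithin ℝ (fun q : ℝ × V3 => Θ₁ q.1 q.2 ^ 2 * γ (P₁ q.1 q.2)) (Ico 0 t₁ ×ˢ univ) p) →
    (∀ p, Dm p = fderivWithin ℝ (fun q : ℝ × V3 => P₁ q.1 q.2 ^ 2 * Θ₁ q.1 q.2) (Ico 0 t₁ ×ˢ univ) p) →
    (∀ p, Dn p = fderivWithin ℝ (fun q : ℝ × V3 => 3 / 2 * P₁ q.1 q.2 ^ 2) (Ico 0 t₁ ×ˢ univ) p) →
    (∀ t y, e t y =
      1 / 2 * (Θ₁ t y ^ 2 * γ (P₁ t y) * (P₁ t y - P₂ t y) ^ 2 + P₁ t y ^ 2 * Θ₁ t y * ‖U₁ t y -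
        U₂ t y‖ ^ 2 + 3 / 2 * P₁ t y ^ 2 * (Θ₁ t y - Θ₂ t y) ^ 2)) →
    (∀ t y, src t y =
      (∑ i, ((DU₁ (t, y)).comp (ContinuousLinearMap.inr ℝ ℝ V3)) (EuclideanSpace.single i 1) i) * e t y +
        (P₁ t y - P₂ t y) * ((Da (t, y)).comp (ContinuousLinearMap.inr ℝ ℝ V3)) (U₁ t y - U₂ t y) +
        (Θ₁ t y - Θ₂ t y) * ((Db (t, y)).comp (ContinuousLinearMap.inr ℝ ℝ V3)) (U₁ t y - U₂ t y) +
        (-(Θ₁ t y ^ 2 * γ (P₁ t y) * (P₁ t y - P₂ t y) *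
        ((DP₂ (t, y)).comp (ContinuousLinearMap.inr ℝ ℝ V3)) (U₁ t y - U₂ t y)) - Θ₁ t y ^ 2 * γ (P₁ t y) *
        (P₁ t y - P₂ t y) ^ 2 *
        ∑ i, ((DU₂ (t, y)).comp (ContinuousLinearMap.inr ℝ ℝ V3)) (EuclideanSpace.single i 1) i -
        P₁ t y ^ 2 * Θ₁ t y * ⟪U₁ t y -
        U₂ t y, ((DU₂ (t, y)).comp (ContinuousLinearMap.inr ℝ ℝ V3)) (U₁ t y - U₂ t y)⟫ - P₁ t y * Θ₁ t y *
        (P₁ t y - P₂ t y) * ⟪U₁ t y -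
        U₂ t y, ((DU₂ (t, y)).comp (ContinuousLinearMap.inr ℝ ℝ V3)) (U₂ t y)⟫ - P₁ t y * Θ₁ t y *
        ((Θ₁ t y - Θ₂ t y) * γ (P₁ t y) + Θ₂ t y * (γ (P₁ t y) - γ (P₂ t y))) *
        ((DP₂ (t, y)).comp (ContinuousLinearMap.inr ℝ ℝ V3)) (U₁ t y - U₂ t y) - P₁ t y * Θ₁ t y *
        ((P₁ t y - P₂ t y) * ζ (P₁ t y) + P₂ t y * (ζ (P₁ t y) - ζ (P₂ t y))) *
        ((DΘ₂ (t, y)).comp (ContinuousLinearMap.inr ℝ ℝ V3)) (U₁ t y - U₂ t y) - P₁ t y * Θ₁ t y * (P₁ t y -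
        P₂ t y) * ⟪U₁ t y - U₂ t y, DU₂ (t, y) (1, 0)⟫ - 3 / 2 * P₁ t y ^ 2 * (Θ₁ t y - Θ₂ t y) *
        ((DΘ₂ (t, y)).comp (ContinuousLinearMap.inr ℝ ℝ V3)) (U₁ t y - U₂ t y) - P₁ t y ^ 2 * (Θ₁ t y -
        Θ₂ t y) * ((Θ₁ t y - Θ₂ t y) * ζ (P₁ t y) + Θ₂ t y * (ζ (P₁ t y) - ζ (P₂ t y))) *
        ∑ i, ((DU₂ (t, y)).comp (ContinuousLinearMap.inr ℝ ℝ V3)) (EuclideanSpace.single i 1) i) + 1 / 2 *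
        (((Dk (t, y)).comp (ContinuousLinearMap.inr ℝ ℝ V3)) (U₁ t y) * (P₁ t y - P₂ t y) ^ 2 +
        ((Dm (t, y)).comp (ContinuousLinearMap.inr ℝ ℝ V3)) (U₁ t y) * ‖U₁ t y - U₂ t y‖ ^ 2 +
        ((Dn (t, y)).comp (ContinuousLinearMap.inr ℝ ℝ V3)) (U₁ t y) * (Θ₁ t y - Θ₂ t y) ^ 2) + 1 / 2 *
        (Dk (t, y) (1, 0) * (P₁ t y - P₂ t y) ^ 2 + Dm (t, y) (1, 0) * ‖U₁ t y - U₂ t y‖ ^ 2 +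
        Dn (t, y) (1, 0) * (Θ₁ t y - Θ₂ t y) ^ 2)) →
    IsCompact K → K ⊆ Ico 0 t₁ ×ˢ univ → 0 < a → 0 < θ₀ → (∀ r ∈ Icc a b, 0 < γ r) →
    (∀ t y, (t, y) ∈ K → P₁ t y ∈ Icc a b ∧ P₂ t y ∈ Icc a b ∧ θ₀ ≤ Θ₁ t y) →
    ∃ M : ℝ, ∀ t y, (t, y) ∈ K → src t y ≤ M * e t y := by
  intro ζ γ P₁ Θ₁ P₂ Θ₂ U₁ U₂ t₁ a b θ₀ K DU₁ DU₂ DP₂ DΘ₂ Da Db Dk Dm Dn e src hζ hγ hP₁ hΘ₁ hU₁ hP₂ hΘ₂ hU₂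
    hDU₁ hDU₂ hDP₂ hDΘ₂ hDa hDb hDk hDm hDn he hsrc hK hKS ha hθ₀ hγpos hKb
  -- ### the empty case
  by_cases hKne : K.Nonempty
  swap
  · exact ⟨0, fun t y h => absurd ⟨(t, y), h⟩ hKne⟩
  -- ### continuity atoms on the slab
  have hP₁c : ContinuousOn (fun p : ℝ × V3 => P₁ p.1 p.2) (Ico 0 t₁ ×ˢ univ) := hP₁.continuousOn
  have hΘ₁c : ContinuousOn (fun p : ℝ × V3 => Θ₁ p.1 p.2) (Ico 0 t₁ ×ˢ univ) := hΘ₁.continuousOn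
  have hU₁c : ContinuousOn (fun p : ℝ × V3 => U₁ p.1 p.2) (Ico 0 t₁ ×ˢ univ) := hU₁.continuousOn
  have hP₂c : ContinuousOn (fun p : ℝ × V3 => P₂ p.1 p.2) (Ico 0 t₁ ×ˢ univ) := hP₂.continuousOn
  have hΘ₂c : ContinuousOn (fun p : ℝ × V3 => Θ₂ p.1 p.2) (Ico 0 t₁ ×ˢ univ) := hΘ₂.continuousOn
  have hU₂c : ContinuousOn (fun p : ℝ × V3 => U₂ p.1 p.2) (Ico 0 t₁ ×ˢ univ) := hU₂.continuousOn
  have hγc : Continuous γ := hγ.continuous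
  have hζc : Continuous ζ := hζ.continuous
  have ha1 : ContDiffOn ℝ 1 (fun q : ℝ × V3 => P₁ q.1 q.2 * Θ₁ q.1 q.2 ^ 2 * γ (P₁ q.1 q.2)) (Ico 0 t₁ ×ˢ univ) := by
    fun_prop
  have hb1 : ContDiffOn ℝ 1 (fun q : ℝ × V3 => P₁ q.1 q.2 ^ 2 * Θ₁ q.1 q.2 * ζ (P₁ q.1 q.2)) (Ico 0 t₁ ×ˢ univ) := by
    fun_prop
  have hk1 : ContDiffOn ℝ 1 (fun q : ℝ × V3 => Θ₁ q.1 q.2 ^ 2 * γ (P₁ q.1 q.2)) (Ico 0 t₁ ×ˢ univ) := by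
    fun_prop
  have hm1 : ContDiffOn ℝ 1 (fun q : ℝ × V3 => P₁ q.1 q.2 ^ 2 * Θ₁ q.1 q.2) (Ico 0 t₁ ×ˢ univ) := by fun_prop
  have hn1 : ContDiffOn ℝ 1 (fun q : ℝ × V3 => 3 / 2 * P₁ q.1 q.2 ^ 2) (Ico 0 t₁ ×ˢ univ) := by fun_prop
  have hDU₁c : ContinuousOn (fun p => DU₁ p) (Ico 0 t₁ ×ˢ univ) := by
    rw [show (fun p => DU₁ p) = _ from funext hDU₁]; exact continuousOn_fderivWithin_slab hU₁
  have hDU₂c : ContinuousOn (fun p => DU₂ p) (Ico 0 t₁ ×ˢ univ) := by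
    rw [show (fun p => DU₂ p) = _ from funext hDU₂]; exact continuousOn_fderivWithin_slab hU₂
  have hDP₂c : ContinuousOn (fun p => DP₂ p) (Ico 0 t₁ ×ˢ univ) := by
    rw [show (fun p => DP₂ p) = _ from funext hDP₂]; exact continuousOn_fderivWithin_slab hP₂
  have hDΘ₂c : ContinuousOn (fun p => DΘ₂ p) (Ico 0 t₁ ×ˢ univ) := by
    rw [show (fun p => DΘ₂ p) = _ from funext hDΘ₂]; exact continuousOn_fderivWithin_slab hΘ₂
  have hDac : ContinuousOn (fun p => Da p) (Ico 0 t₁ ×ˢ univ) := by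
    rw [show (fun p => Da p) = _ from funext hDa]; exact continuousOn_fderivWithin_slab ha1
  have hDbc : ContinuousOn (fun p => Db p) (Ico 0 t₁ ×ˢ univ) := by
    rw [show (fun p => Db p) = _ from funext hDb]; exact continuousOn_fderivWithin_slab hb1
  have hDkc : ContinuousOn (fun p => Dk p) (Ico 0 t₁ ×ˢ univ) := by
    rw [show (fun p => Dk p) = _ from funext hDk]; exact continuousOn_fderivWithin_slab hk1
  have hDmc : ContinuousOn (fun p => Dm p) (Ico 0 t₁ ×ˢ univ) := by
    rw [show (fun p => Dm p) = _ from funext hDm]; exact continuousOn_fderivWithin_slab hm1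
  have hDnc : ContinuousOn (fun p => Dn p) (Ico 0 t₁ ×ˢ univ) := by
    rw [show (fun p => Dn p) = _ from funext hDn]; exact continuousOn_fderivWithin_slab hn1
  -- ### the source as a `2`-homogeneous function of the difference variables
  set Q : ℝ × V3 → ℝ × V3 × ℝ × ℝ × ℝ → ℝ := fun p v =>
    (∑ i, ((DU₁ p).comp (ContinuousLinearMap.inr ℝ ℝ V3)) (EuclideanSpace.single i 1) i) * (1 / 2 *
      (Θ₁ p.1 p.2 ^ 2 * γ (P₁ p.1 p.2) * v.1 ^ 2 + P₁ p.1 p.2 ^ 2 * Θ₁ p.1 p.2 * ‖v.2.1‖ ^ 2 + 3 / 2 *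
      P₁ p.1 p.2 ^ 2 * v.2.2.1 ^ 2)) + v.1 * ((Da p).comp (ContinuousLinearMap.inr ℝ ℝ V3)) v.2.1 +
      v.2.2.1 * ((Db p).comp (ContinuousLinearMap.inr ℝ ℝ V3)) v.2.1 + (-(Θ₁ p.1 p.2 ^ 2 * γ (P₁ p.1 p.2) *
      v.1 * ((DP₂ p).comp (ContinuousLinearMap.inr ℝ ℝ V3)) v.2.1) - Θ₁ p.1 p.2 ^ 2 * γ (P₁ p.1 p.2) *
      v.1 ^ 2 * ∑ i, ((DU₂ p).comp (ContinuousLinearMap.inr ℝ ℝ V3)) (EuclideanSpace.single i 1) i -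
      P₁ p.1 p.2 ^ 2 * Θ₁ p.1 p.2 * ⟪v.2.1, ((DU₂ p).comp (ContinuousLinearMap.inr ℝ ℝ V3)) v.2.1⟫ -
      P₁ p.1 p.2 * Θ₁ p.1 p.2 * v.1 *
      ⟪v.2.1, ((DU₂ p).comp (ContinuousLinearMap.inr ℝ ℝ V3)) (U₂ p.1 p.2)⟫ - P₁ p.1 p.2 * Θ₁ p.1 p.2 *
      (v.2.2.1 * γ (P₁ p.1 p.2) + Θ₂ p.1 p.2 * v.2.2.2.2) *
      ((DP₂ p).comp (ContinuousLinearMap.inr ℝ ℝ V3)) v.2.1 - P₁ p.1 p.2 * Θ₁ p.1 p.2 * (v.1 *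
      ζ (P₁ p.1 p.2) + P₂ p.1 p.2 * v.2.2.2.1) * ((DΘ₂ p).comp (ContinuousLinearMap.inr ℝ ℝ V3)) v.2.1 -
      P₁ p.1 p.2 * Θ₁ p.1 p.2 * v.1 * ⟪v.2.1, DU₂ p (1, 0)⟫ - 3 / 2 * P₁ p.1 p.2 ^ 2 * v.2.2.1 *
      ((DΘ₂ p).comp (ContinuousLinearMap.inr ℝ ℝ V3)) v.2.1 - P₁ p.1 p.2 ^ 2 * v.2.2.1 * (v.2.2.1 *
      ζ (P₁ p.1 p.2) + Θ₂ p.1 p.2 * v.2.2.2.1) *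
      ∑ i, ((DU₂ p).comp (ContinuousLinearMap.inr ℝ ℝ V3)) (EuclideanSpace.single i 1) i) + 1 / 2 *
      (((Dk p).comp (ContinuousLinearMap.inr ℝ ℝ V3)) (U₁ p.1 p.2) * v.1 ^ 2 +
      ((Dm p).comp (ContinuousLinearMap.inr ℝ ℝ V3)) (U₁ p.1 p.2) * ‖v.2.1‖ ^ 2 +
      ((Dn p).comp (ContinuousLinearMap.inr ℝ ℝ V3)) (U₁ p.1 p.2) * v.2.2.1 ^ 2) + 1 / 2 * (Dk p (1, 0) *
      v.1 ^ 2 + Dm p (1, 0) * ‖v.2.1‖ ^ 2 + Dn p (1, 0) * v.2.2.1 ^ 2) with hQ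
  have hQc : ContinuousOn (fun q : (ℝ × V3) × (ℝ × V3 × ℝ × ℝ × ℝ) => Q q.1 q.2)
      ((Ico 0 t₁ ×ˢ univ) ×ˢ univ) := by
    simp only [hQ]
    fun_prop (config := { maxSteps := 4000000 })
      (disch := (intro q hq; simp only [Set.mem_prod, Set.mem_univ, and_true, Prod.mk.eta] at hq ⊢; exact hq))
  have hhom : ∀ p ∈ K, ∀ (s : ℝ) (v : ℝ × V3 × ℝ × ℝ × ℝ), Q p (s • v) = s ^ 2 * Q p v := by
    intro p _ s v
    simp only [hQ, Prod.smul_fst, Prod.smul_snd, smul_eq_mul, map_smul, inner_smul_left, inner_smul_right,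
      norm_smul, Real.norm_eq_abs, mul_pow, sq_abs, conj_trivial]
    ring
  obtain ⟨M₀, hM₀0, hM₀⟩ := exists_bound_of_isCompact_of_homogeneous hK
    (hQc.mono (prod_mono hKS le_rfl)) hhom
  -- ### Lipschitz bounds, lower bounds
  obtain ⟨Lζ, hLζ0, hLζ⟩ := exists_abs_sub_le_mul_of_contDiff hζ a b
  obtain ⟨Lγ, hLγ0, hLγ⟩ := exists_abs_sub_le_mul_of_contDiff hγ a b
  obtain ⟨⟨t₀, y₀⟩, hp₀⟩ := hKne
  obtain ⟨r₀, hr₀, hr₀min⟩ := isCompact_Icc.exists_isMinOn ⟨_, (hKb t₀ y₀ hp₀).1⟩ hγc.continuousOn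
  set γ₀ : ℝ := γ r₀ with hγ₀
  have hγ₀pos : 0 < γ₀ := hγpos r₀ hr₀
  have hγ₀le : ∀ r ∈ Icc a b, γ₀ ≤ γ r := fun r hr => hr₀min hr
  set μ : ℝ := min (θ₀ ^ 2 * γ₀) (min (a ^ 2 * θ₀) (3 / 2 * a ^ 2)) with hμ
  have hμpos : 0 < μ := by rw [hμ]; positivity
  refine ⟨M₀ * (1 + Lζ ^ 2 + Lγ ^ 2) * (2 / μ), fun t y hty => ?_⟩
  obtain ⟨hP₁ab, hP₂ab, hΘ₁θ⟩ := hKb t y hty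
  -- the difference variables
  set α : ℝ := P₁ t y - P₂ t y with hα
  set w : V3 := U₁ t y - U₂ t y with hw
  set β : ℝ := Θ₁ t y - Θ₂ t y with hβ
  set dζ : ℝ := ζ (P₁ t y) - ζ (P₂ t y) with hdζ
  set dγ : ℝ := γ (P₁ t y) - γ (P₂ t y) with hdγ
  set qq : ℝ := α ^ 2 + ‖w‖ ^ 2 + β ^ 2 with hqq
  have hsrcQ : src t y = Q (t, y) (α, w, β, dζ, dγ) := by rw [hsrc, he]
  -- `src ≤ M₀ ‖v‖² ≤ M₀ (1 + Lζ² + Lγ²) q`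
  have hdζ2 : dζ ^ 2 ≤ Lζ ^ 2 * α ^ 2 := by
    have h := hLζ _ hP₁ab _ hP₂ab
    have h2 := pow_le_pow_left₀ (abs_nonneg _) h 2
    rw [sq_abs, mul_pow, sq_abs] at h2
    exact h2
  have hdγ2 : dγ ^ 2 ≤ Lγ ^ 2 * α ^ 2 := by
    have h := hLγ _ hP₁ab _ hP₂ab
    have h2 := pow_le_pow_left₀ (abs_nonneg _) h 2
    rw [sq_abs, mul_pow, sq_abs] at h2
    exact h2
  have hv : ‖((α, w, β, dζ, dγ) : ℝ × V3 × ℝ × ℝ × ℝ)‖ ^ 2 ≤ (1 + Lζ ^ 2 + Lγ ^ 2) * qq := by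
    refine (norm_sq_le_five _).trans ?_
    simp only
    rw [hqq]
    nlinarith [sq_nonneg α, norm_nonneg w, sq_nonneg β, mul_nonneg (sq_nonneg Lζ) (sq_nonneg β),
      mul_nonneg (sq_nonneg Lγ) (sq_nonneg β), mul_nonneg (sq_nonneg Lζ) (sq_nonneg ‖w‖),
      mul_nonneg (sq_nonneg Lγ) (sq_nonneg ‖w‖)]
  have h1 : src t y ≤ M₀ * ((1 + Lζ ^ 2 + Lγ ^ 2) * qq) := by
    rw [hsrcQ]
    exact (hM₀ (t, y) hty _).trans (mul_le_mul_of_nonneg_left hv hM₀0)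
  -- coercivity `(μ/2) q ≤ ẽ`
  have hΘpos : 0 < Θ₁ t y := hθ₀.trans_le hΘ₁θ
  have hk : θ₀ ^ 2 * γ₀ ≤ Θ₁ t y ^ 2 * γ (P₁ t y) :=
    mul_le_mul (pow_le_pow_left₀ hθ₀.le hΘ₁θ 2) (hγ₀le _ hP₁ab) hγ₀pos.le (sq_nonneg _)
  have hm : a ^ 2 * θ₀ ≤ P₁ t y ^ 2 * Θ₁ t y :=
    mul_le_mul (pow_le_pow_left₀ ha.le hP₁ab.1 2) hΘ₁θ hθ₀.le (sq_nonneg _)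
  have hn : 3 / 2 * a ^ 2 ≤ 3 / 2 * P₁ t y ^ 2 := by
    have := pow_le_pow_left₀ ha.le hP₁ab.1 2; linarith
  have hμk : μ ≤ Θ₁ t y ^ 2 * γ (P₁ t y) := (min_le_left _ _).trans hk
  have hμm : μ ≤ P₁ t y ^ 2 * Θ₁ t y := ((min_le_right _ _).trans (min_le_left _ _)).trans hm
  have hμn : μ ≤ 3 / 2 * P₁ t y ^ 2 := ((min_le_right _ _).trans (min_le_right _ _)).trans hn
  have h2 : μ / 2 * qq ≤ e t y := by
    rw [he, hqq]
    nlinarith [mul_le_mul_of_nonneg_right hμk (sq_nonneg α), mul_le_mul_of_nonneg_right hμm (sq_nonneg ‖w‖),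
      mul_le_mul_of_nonneg_right hμn (sq_nonneg β)]
  have hqq0 : 0 ≤ qq := by rw [hqq]; positivity
  have h3 : qq ≤ 2 / μ * e t y :=
    calc qq = 2 / μ * (μ / 2 * qq) := by field_simp
      _ ≤ 2 / μ * e t y := mul_le_mul_of_nonneg_left h2 (by positivity)
  calc src t y ≤ M₀ * ((1 + Lζ ^ 2 + Lγ ^ 2) * qq) := h1
    _ = M₀ * (1 + Lζ ^ 2 + Lγ ^ 2) * qq := by ring
    _ ≤ M₀ * (1 + Lζ ^ 2 + Lγ ^ 2) * (2 / μ * e t y) := mul_le_mul_of_nonneg_left h3 (by positivity)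
    _ = M₀ * (1 + Lζ ^ 2 + Lγ ^ 2) * (2 / μ) * e t y := by ring

end ConeLocality

end Summit.AtomisticToContinuum.HydrodynamicLimit.Theorems.KidderKnobMelnikov

end
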